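import Summits.QuantumFields.YangMills.Theorems.BalabanUVNodesN15CurvedGluingSpeciesCommutatorAdjointSandwichDefect
import Summits.QuantumFields.YangMills.Theorems.BalabanUVNodesN15CurvedGluingCubeSmoothCutDressedAdjointRowSandwich
import Summits.QuantumFields.YangMills.Theorems.BalabanUVNodesN15TwoSpacingGluingNeumannKnitRightDefectCube
import HarnessLib

/-!
# THE TWO-SPACING η-DEFECT OF THE ADJOINT REMAINDER ROW FROM SANDWICHED RIGHT ENTRIES, GENERIC CUBE: `𝔇(G′∘[lapOp′ W′ + N_L′ − 𝒱′, M_{h′}], G∘[lapOp W + N_L − 𝒱, M_h]) ≤ 1_S(y)·Θ_D·e^{−ρd}`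
# (FILE 147∕149's `hDK`) for ANY pair of cube operators `G, G′` with two-sided rows, defect, and SANDWICHED right entries `G∘∇^±∘M_χ = T^±∘M_χ` at both grids — g13's flat twin, dag-n15-w5's
# nonlocal twin and FILE 154's species twin assembled (dag-n15-c g18, FILE 155; N15 = NE2, s1 «background-layer OPERATOR ingredient»)

Cell `pub-ymgap`, seat `pub-ymgap-dag-n15-c` (R134 (a); HUMAN RULING D-0062), generation 18.  `bears_on: R4∕N15 · K3⁸ SpineGivenEndpointR13SepCoPHV (stmt-QuantumFields-27366)`.
Filed `--kind proof --supports stmt-QuantumFields-27366 --as helper` — COUNT-NEUTRAL.  Theorems only; 0 `def`, 0 `sorry`.  Imports BY NAME FILE 154 `…SpeciesCommutatorAdjointSandwichDefect`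
(`hasMaj_idef_comp_commOp_dressedPert_of_sandwich`), FILE 153 `…CubeSmoothCutDressedAdjointRowSandwich` (`comp_mulOp_of_sandwich`), dag-n15-c g13 FILE 97 `…NeumannKnitRightDefectCube`
(`hasMaj_idef_comp_commOp_lapOp_of_sandwich`), dag-n15-w5 `hasMaj_idef_comp_commOp_of_add`, dag-n15-w3 `commOp_sub_left`, lit `idef_sub`.  Nothing in the tree is modified; nothing restated.

WHY.  FILE 153 gave the ONE-GRID adjoint remainder row of the adjoint-side dressed cube from sandwiched right entries; FILE 147∕149's two-grid theorem also needs its η-DEFECT `hDK`.  The three halves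
have two-grid twins in the tree that read right entries only behind diagonal factors supported in the transition layers: g13's `hasMaj_idef_comp_commOp_lapOp_of_sandwich` (flat `Σ∇*∇ + W`),
dag-n15-w5's `hasMaj_idef_comp_commOp_of_add` (nonlocal `N_L` through the cube's output), FILE 154 (species + base).  THIS FILE assembles them for a GENERIC pair `(G, G′)` — the cube enters
only through its fine two-sided rows, its defect `𝔇(G′,G)`, its SANDWICHED right entries `G∘∇^±_μ∘M_χ = T^±_μ∘M_χ` at both grids, the sandwiched operators' fine rows and defects
`𝔇(T′^±, T^±)`, and the `W`-row's defect — so that the instantiation `G := X°` (FILE 153's cube; `T^± := Ñ_𝒲∘M_χ̃∘T^±_N`, defects by FILE 148 §3 + FILE 151) is pure plumbing (next file).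

WHAT.  ★★★ `hasMaj_idef_comp_commOp_cubeOp_out_of_sandwich`: `𝔇 ≤ 1_S(y)·[(|J|(3(βo₂ + m₀c₂) + 2(β₁o₁ + m₁c₁)) + r_W) + βr_Kc_r + m₀c_Kc_r + r_V + βr_K′c_r + m₀c_K′c_r]·e^{−ρd}` — precisely g13's
constant + w5's nonlocal constants (`c_K = c_N`, `r_K = r_N`) + FILE 154's species∕base constants, at a rate `ρ` with `ρ ≤ ρ_N`, `ρ ≤ δ_N − ε`, `ρ + σ ≤ δ` (`δ` = the common rate of the two-sided rows).

HONEST FRAMING ∕ LIMITS.  Block-majorant bookkeeping over DISPLAYED letters at both grids; proves NO estimate of any concrete propagator; nothing of [B5]∕[B6]∕[B9] asserted ((1.120)–(1.128),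
(2.91)–(2.92) p.239, (2.133)–(2.134) p.247, (3.52) p.400, (3.62)–(3.65) pp.402–403, (3.76)–(3.77) pp.405–406 = SHAPES; Thm 3.14 pp.426–427 = difference TEMPLATE).  NE2⁺ NOT PRINTED, NOT proved; N15
NOT discharged; K3⁸ OPEN, skeleton v7 untouched (0∕2); counts of record UNMOVED by this seat (typed 28∕28 · discharged 7∕28 = 7∕27 excl. NODE O, №245); one finite 𝕋⁴ at fixed ε — NOT infinite volume, NOT OS on ℝ⁴, NOT a
mass gap, NOT Clay; R4 closes the conditional finite-𝕋⁴ rung `BalabanLadder.UV` only.  Restate-immune (no Theses import).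
-/

set_option autoImplicit false

noncomputable section
open scoped BigOperators
open Finset

namespace Summit.QuantumFields.YangMills.BalabanUVNodes.N15.Gluing

open Literature.MathematicalPhysics.QuantumFieldTheory.Balaban1983to89
open Literature.MathematicalPhysics.QuantumFieldTheory.Balaban1983to89.B11SectG (BlockNorm HasMaj RowSum)
open Literature.MathematicalPhysics.QuantumFieldTheory.Balaban1983to89.B6RandomWalk (Triangle254)
open Literature.MathematicalPhysics.QuantumFieldTheory.Balaban1983to89.T4EtaRateDefect (idef idef_sub)
open Literature.MathematicalPhysics.QuantumFieldTheory.Balaban1983to89.T4EtaRateCoeffDefect (pull)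
open Literature.MathematicalPhysics.QuantumFieldTheory.Balaban1983to89.B6Prop26Gluing (mulOp mulOp_apply ind ind_nonneg)
open Summit.QuantumFields.YangMills.BalabanUVNodes.N15.MatrixSpecies (mmulOp liftBlk liftMap liftEquiv liftEquiv_apply liftEquiv_symm_apply)
open Summit.QuantumFields.YangMills.BalabanUVNodes.N15.BackgroundLayer (fgrad bgrad fgradAdj fgrad_apply bgrad_apply stack projO unstackM)
open Summit.QuantumFields.YangMills.BalabanUVNodes.N15.CurvedSpecies (hasMaj_idef_comp_commOp_of_add commOp_sub_left)

variable {X X' ι J : Type} [Fintype X] [Fintype X'] [Fintype ι] [DecidableEq ι] [Fintype J] [DecidableEq J] {g : B6.Geometry} (blk : X → g.Site) (π : X' → X)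
  (τ : J → X ≃ X) (τ' : J → X' ≃ X') (n n' : ℝ) (C : X → Matrix ι ι ℝ) (C' : X' → Matrix ι ι ℝ) (A : J ⊕ J → X → Matrix ι ι ℝ) (A' : J ⊕ J → X' → Matrix ι ι ℝ) (hX : X → ℝ) (hX' : X' → ℝ)
  (G : (X × ι → ℝ) →ₗ[ℝ] (X × ι → ℝ)) (G' : (X' × ι → ℝ) →ₗ[ℝ] (X' × ι → ℝ)) {σ cr : ℝ} {χX : X → ℝ} {χX' : X' → ℝ}
  {W NL NV : (X × ι → ℝ) →ₗ[ℝ] (X × ι → ℝ)} {W' NL' NV' : (X' × ι → ℝ) →ₗ[ℝ] (X' × ι → ℝ)} {TD TB : J → (X × ι → ℝ) →ₗ[ℝ] (X × ι → ℝ)} {TD' TB' : J → (X' × ι → ℝ) →ₗ[ℝ] (X' × ι → ℝ)}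

/-- ★★★ **THE TWO-SPACING η-DEFECT OF THE ADJOINT REMAINDER ROW FROM SANDWICHED RIGHT ENTRIES** (FILE 147∕149's `hDK`), generic cube pair `(G, G′)`.  Data at both grids (coarse unprimed on
`X × ι`, fine primed on `X′ × ι`, pairing `π`), all two-sided rows at ONE rate `δ`: fine cube `G′ ≤ 1_S1_Sβ`, defect `𝔇(G′,G) ≤ 1_S1_Sm₀`; SANDWICHED right entries `G∘∇^±_μ∘M_χ = T^±_μ∘M_χ`,
`G′∘∇′^±_μ∘M_{χ′} = T′^±_μ∘M_{χ′}` with fine rows `T′^± ≤ 1_S1_Sβ₁` and defects `𝔇(T′^±,T^±) ≤ 1_S1_Sm₁`; the partition `h = h_X∘pr₁`, `h′`: g13's lifted coefficient letters (`c₁, c₂`) and fits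
(`o₁, o₂`), FILE 154's scalar letters (`c₁, c₀`) at both grids and fits (`o₁, o₀`), `|h′ − h∘π| ≤ o`, `h, h′` within `ω` of an `ℓ`-block-Lipschitz block constant; transition layers inside
`{χ = 1}`, `{χ′ = 1}`; species rows `r_A`, translated fits `o_At`; the `W`-rows' defect `r_W`; the flat nonlocal commutator letters `[N_L, M_h] ≤ c_Ne^{−ρ_Nd}`, `𝔇 ≤ r_Ne^{−ρ_Nd}`; base parts
`N_V, N_V′ ≤ R_Ne^{−δ_Nd}`, `𝔇(N_V′,N_V) ≤ r_Ve^{−δ_Nd}`; `ε > 0`; a rate `ρ ≥ 0` with `ρ ≤ ρ_N`, `ρ ≤ δ_N − ε`, `ρ + σ ≤ δ`.  Then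
`𝔇(G′∘[lapOp′ W′ + N_L′ − 𝒱′, M_{h′}], G∘[lapOp W + N_L − 𝒱, M_h]) ≤ 1_S(y)·[(|J|(3(βo₂ + m₀c₂) + 2(β₁o₁ + m₁c₁)) + r_W + βr_Nc_r + m₀c_Nc_r) + (r_V + β((ℓ(eε)⁻¹ + 2ω)r_V′ + 2oR_N)c_r +
m₀(ℓ(eε)⁻¹ + 2ω)R_Nc_r)]·e^{−ρd}`, `r_V = |J|·2(r_A(c₁m₀ + o₁β + c₀m₁ + o₀β₁) + o_At(c₁β + c₀β₁))`, `𝒱 = (unstackM C A + N_V∘pr₀)∘jet`.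
[cite: Balaban1984PropagatorsI, (1.120)–(1.128) pp.37–38, p.39; Balaban1984PropagatorsII, (2.91)–(2.92) p.239, (2.133)–(2.134) p.247 (shapes, transposed); Balaban1985BackgroundPropagators, (3.52) p.400, (3.62)–(3.65) pp.402–403, (3.76)–(3.77) pp.405–406, Thm 3.14 pp.426–427 (difference template)] -/
theorem hasMaj_idef_comp_commOp_cubeOp_out_of_sandwich (htri : Triangle254 g) (hd : ∀ a b : g.Site, 0 ≤ g.dist a b) (hsymm : ∀ y y', g.dist y y' = g.dist y' y) (hrow : RowSum g σ cr)
    (hσ : 0 ≤ σ) {S : Set g.Site} {hb : g.Site → ℝ} {β β₁ m₀ m₁ c₁ c₂ c₀ o₁ o₂ o₀ o rA oAt rW cN rN RN rV δ ρN δN ε ℓ ω ρ : ℝ}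
    (hβ : 0 ≤ β) (hβ₁ : 0 ≤ β₁) (hm₀ : 0 ≤ m₀) (hm₁ : 0 ≤ m₁) (hc₁ : 0 ≤ c₁) (hc₂ : 0 ≤ c₂) (hc₀ : 0 ≤ c₀) (ho₁ : 0 ≤ o₁) (ho₂ : 0 ≤ o₂) (ho₀ : 0 ≤ o₀) (ho : 0 ≤ o) (hrA : 0 ≤ rA)
    (hoAt : 0 ≤ oAt) (hrW : 0 ≤ rW) (hcN : 0 ≤ cN) (hrN : 0 ≤ rN) (hRN : 0 ≤ RN) (hrV : 0 ≤ rV) (hℓ : 0 ≤ ℓ) (hω : 0 ≤ ω) (hε : 0 < ε) (hρ : 0 ≤ ρ) (hρN : ρ ≤ ρN) (hρV : ρ ≤ δN - ε)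
    (hρδ : ρ + σ ≤ δ)
    -- g13's lifted partition letters (coarse) and their two-grid fits
    (hhD : ∀ μ p, |(fgrad n (liftEquiv (τ μ) ι) (fun p : X × ι => hX p.1) ∘ ⇑(liftEquiv (τ μ) ι).symm) p| ≤ c₁)
    (hhB : ∀ μ p, |(bgrad n (liftEquiv (τ μ) ι) (fun p : X × ι => hX p.1) ∘ ⇑(liftEquiv (τ μ) ι)) p| ≤ c₁)
    (hh2 : ∀ μ p, |fgradAdj n (liftEquiv (τ μ) ι) (fgrad n (liftEquiv (τ μ) ι) (fun p : X × ι => hX p.1)) p| ≤ c₂)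
    (hh2f : ∀ μ p, |(fgrad n (liftEquiv (τ μ) ι) (fgrad n (liftEquiv (τ μ) ι) (fun p : X × ι => hX p.1)) ∘ ⇑(liftEquiv (τ μ) ι).symm) p| ≤ c₂)
    (hh2b : ∀ μ p, |bgrad n (liftEquiv (τ μ) ι) (bgrad n (liftEquiv (τ μ) ι) (fun p : X × ι => hX p.1) ∘ ⇑(liftEquiv (τ μ) ι)) p| ≤ c₂)
    (hfD : ∀ μ p', |(fgrad n' (liftEquiv (τ' μ) ι) (fun p : X' × ι => hX' p.1) ∘ ⇑(liftEquiv (τ' μ) ι).symm) p' - (fgrad n (liftEquiv (τ μ) ι) (fun p : X × ι => hX p.1) ∘ ⇑(liftEquiv (τ μ) ι).symm) (liftMap π ι p')| ≤ o₁)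
    (hfB : ∀ μ p', |(bgrad n' (liftEquiv (τ' μ) ι) (fun p : X' × ι => hX' p.1) ∘ ⇑(liftEquiv (τ' μ) ι)) p' - (bgrad n (liftEquiv (τ μ) ι) (fun p : X × ι => hX p.1) ∘ ⇑(liftEquiv (τ μ) ι)) (liftMap π ι p')| ≤ o₁)
    (hf2 : ∀ μ p', |fgradAdj n' (liftEquiv (τ' μ) ι) (fgrad n' (liftEquiv (τ' μ) ι) (fun p : X' × ι => hX' p.1)) p' - fgradAdj n (liftEquiv (τ μ) ι) (fgrad n (liftEquiv (τ μ) ι) (fun p : X × ι => hX p.1)) (liftMap π ι p')| ≤ o₂)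
    (hf2f : ∀ μ p', |(fgrad n' (liftEquiv (τ' μ) ι) (fgrad n' (liftEquiv (τ' μ) ι) (fun p : X' × ι => hX' p.1)) ∘ ⇑(liftEquiv (τ' μ) ι).symm) p' -
      (fgrad n (liftEquiv (τ μ) ι) (fgrad n (liftEquiv (τ μ) ι) (fun p : X × ι => hX p.1)) ∘ ⇑(liftEquiv (τ μ) ι).symm) (liftMap π ι p')| ≤ o₂)
    (hf2b : ∀ μ p', |bgrad n' (liftEquiv (τ' μ) ι) (bgrad n' (liftEquiv (τ' μ) ι) (fun p : X' × ι => hX' p.1) ∘ ⇑(liftEquiv (τ' μ) ι)) p' -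
      bgrad n (liftEquiv (τ μ) ι) (bgrad n (liftEquiv (τ μ) ι) (fun p : X × ι => hX p.1) ∘ ⇑(liftEquiv (τ μ) ι)) (liftMap π ι p')| ≤ o₂)
    -- FILE 154's scalar partition letters at both grids, fits, block-constant comparison
    (hh1 : ∀ μ x, |fgrad n (τ μ) hX x| ≤ c₁) (hh1b : ∀ μ x, |bgrad n (τ μ) hX x| ≤ c₁) (hh0 : ∀ μ x, |hX (τ μ x) - hX x| ≤ c₀)
    (hh1' : ∀ μ x', |fgrad n' (τ' μ) hX' x'| ≤ c₁) (hh1b' : ∀ μ x', |bgrad n' (τ' μ) hX' x'| ≤ c₁) (hh0' : ∀ μ x', |hX' (τ' μ x') - hX' x'| ≤ c₀)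
    (hf1 : ∀ μ x', |fgrad n' (τ' μ) hX' x' - fgrad n (τ μ) hX (π x')| ≤ o₁) (hf1b : ∀ μ x', |bgrad n' (τ' μ) hX' x' - bgrad n (τ μ) hX (π x')| ≤ o₁)
    (hf0 : ∀ μ x', |(hX' (τ' μ x') - hX' x') - (hX (τ μ (π x')) - hX (π x'))| ≤ o₀)
    (hf0b : ∀ μ x', |(hX' x' - hX' ((τ' μ).symm x')) - (hX (π x') - hX ((τ μ).symm (π x')))| ≤ o₀)
    (hfit : ∀ x', |hX' x' - hX (π x')| ≤ o) (hLip : ∀ y y', |hb y - hb y'| ≤ ℓ * g.dist y y') (hrh : ∀ x, |hX x - hb (blk x)| ≤ ω) (hrh' : ∀ x', |hX' x' - hb (blk (π x'))| ≤ ω)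
    -- transition layers inside the cuts
    (hlayf : ∀ μ x, hX x ≠ hX ((τ μ).symm x) → χX x = 1) (hlayb : ∀ μ x, hX (τ μ x) ≠ hX x → χX x = 1)
    (hlayf' : ∀ μ x', hX' x' ≠ hX' ((τ' μ).symm x') → χX' x' = 1) (hlayb' : ∀ μ x', hX' (τ' μ x') ≠ hX' x' → χX' x' = 1)
    -- species rows and translated fits
    (hA : ∀ j x i, ∑ k, |A j x i k| ≤ rA)
    (hfAb : ∀ μ x' i, ∑ k, |A' (Sum.inl μ) ((τ' μ).symm x') i k - A (Sum.inl μ) ((τ μ).symm (π x')) i k| ≤ oAt)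
    (hfAf : ∀ μ x' i, ∑ k, |A' (Sum.inr μ) (τ' μ x') i k - A (Sum.inr μ) (τ μ (π x')) i k| ≤ oAt)
    -- the sandwiched right entries at both grids
    (hsXf : ∀ μ, G ∘ₗ fgrad n (liftEquiv (τ μ) ι) ∘ₗ mulOp (fun p : X × ι => χX p.1) = TD μ ∘ₗ mulOp (fun p : X × ι => χX p.1))
    (hsXb : ∀ μ, G ∘ₗ bgrad n (liftEquiv (τ μ) ι) ∘ₗ mulOp (fun p : X × ι => χX p.1) = TB μ ∘ₗ mulOp (fun p : X × ι => χX p.1))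
    (hsXf' : ∀ μ, G' ∘ₗ fgrad n' (liftEquiv (τ' μ) ι) ∘ₗ mulOp (fun p : X' × ι => χX' p.1) = TD' μ ∘ₗ mulOp (fun p : X' × ι => χX' p.1))
    (hsXb' : ∀ μ, G' ∘ₗ bgrad n' (liftEquiv (τ' μ) ι) ∘ₗ mulOp (fun p : X' × ι => χX' p.1) = TB' μ ∘ₗ mulOp (fun p : X' × ι => χX' p.1))
    -- fine two-sided rows and two-sided defects, rate δ
    (hG' : HasMaj (BlockNorm.ofBlocks g (liftBlk (blk ∘ π) ι)) (BlockNorm.ofBlocks g (liftBlk (blk ∘ π) ι)) G' (fun y y' => ind S y * ind S y' * (β * Real.exp (-(δ * g.dist y y')))))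
    (hTD' : ∀ μ, HasMaj (BlockNorm.ofBlocks g (liftBlk (blk ∘ π) ι)) (BlockNorm.ofBlocks g (liftBlk (blk ∘ π) ι)) (TD' μ) (fun y y' => ind S y * ind S y' * (β₁ * Real.exp (-(δ * g.dist y y')))))
    (hTB' : ∀ μ, HasMaj (BlockNorm.ofBlocks g (liftBlk (blk ∘ π) ι)) (BlockNorm.ofBlocks g (liftBlk (blk ∘ π) ι)) (TB' μ) (fun y y' => ind S y * ind S y' * (β₁ * Real.exp (-(δ * g.dist y y')))))
    (hDG : HasMaj (BlockNorm.ofBlocks g (liftBlk blk ι)) (BlockNorm.ofBlocks g (liftBlk (blk ∘ π) ι)) (idef (pull (liftMap π ι)) (pull (liftMap π ι)) G' G)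
      (fun y y' => ind S y * ind S y' * (m₀ * Real.exp (-(δ * g.dist y y')))))
    (hDTD : ∀ μ, HasMaj (BlockNorm.ofBlocks g (liftBlk blk ι)) (BlockNorm.ofBlocks g (liftBlk (blk ∘ π) ι)) (idef (pull (liftMap π ι)) (pull (liftMap π ι)) (TD' μ) (TD μ))
      (fun y y' => ind S y * ind S y' * (m₁ * Real.exp (-(δ * g.dist y y')))))
    (hDTB : ∀ μ, HasMaj (BlockNorm.ofBlocks g (liftBlk blk ι)) (BlockNorm.ofBlocks g (liftBlk (blk ∘ π) ι)) (idef (pull (liftMap π ι)) (pull (liftMap π ι)) (TB' μ) (TB μ))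
      (fun y y' => ind S y * ind S y' * (m₁ * Real.exp (-(δ * g.dist y y')))))
    -- the `W`-rows' defect, the flat nonlocal commutator letters, the base parts
    (hDW : HasMaj (BlockNorm.ofBlocks g (liftBlk blk ι)) (BlockNorm.ofBlocks g (liftBlk (blk ∘ π) ι))
      (idef (pull (liftMap π ι)) (pull (liftMap π ι)) (G' ∘ₗ commOp W' (fun p : X' × ι => hX' p.1)) (G ∘ₗ commOp W (fun p : X × ι => hX p.1))) (fun y y' => ind S y * ind S y' * (rW * Real.exp (-(δ * g.dist y y')))))
    (hKN : HasMaj (BlockNorm.ofBlocks g (liftBlk blk ι)) (BlockNorm.ofBlocks g (liftBlk blk ι)) (commOp NL (fun p : X × ι => hX p.1)) (fun y y' => cN * Real.exp (-(ρN * g.dist y y'))))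
    (hDKN : HasMaj (BlockNorm.ofBlocks g (liftBlk blk ι)) (BlockNorm.ofBlocks g (liftBlk (blk ∘ π) ι))
      (idef (pull (liftMap π ι)) (pull (liftMap π ι)) (commOp NL' (fun p : X' × ι => hX' p.1)) (commOp NL (fun p : X × ι => hX p.1))) (fun y y' => rN * Real.exp (-(ρN * g.dist y y'))))
    (hNV : HasMaj (BlockNorm.ofBlocks g (liftBlk blk ι)) (BlockNorm.ofBlocks g (liftBlk blk ι)) NV (fun y y' => RN * Real.exp (-(δN * g.dist y y'))))
    (hNV' : HasMaj (BlockNorm.ofBlocks g (liftBlk (blk ∘ π) ι)) (BlockNorm.ofBlocks g (liftBlk (blk ∘ π) ι)) NV' (fun y y' => RN * Real.exp (-(δN * g.dist y y'))))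
    (hDNV : HasMaj (BlockNorm.ofBlocks g (liftBlk blk ι)) (BlockNorm.ofBlocks g (liftBlk (blk ∘ π) ι)) (idef (pull (liftMap π ι)) (pull (liftMap π ι)) NV' NV) (fun y y' => rV * Real.exp (-(δN * g.dist y y')))) :
    HasMaj (BlockNorm.ofBlocks g (liftBlk blk ι)) (BlockNorm.ofBlocks g (liftBlk (blk ∘ π) ι))
      (idef (pull (liftMap π ι)) (pull (liftMap π ι))
        (G' ∘ₗ commOp (lapOp n' (fun μ => liftEquiv (τ' μ) ι) W' + NL' - (unstackM C' A' + NV' ∘ₗ projO (none : Option (J ⊕ J))) ∘ₗ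
          stack LinearMap.id (fun j : J ⊕ J => Sum.elim (fun μ => fgrad n' (liftEquiv (τ' μ) ι)) (fun μ => bgrad n' (liftEquiv (τ' μ) ι)) j)) (fun p : X' × ι => hX' p.1))
        (G ∘ₗ commOp (lapOp n (fun μ => liftEquiv (τ μ) ι) W + NL - (unstackM C A + NV ∘ₗ projO (none : Option (J ⊕ J))) ∘ₗ
          stack LinearMap.id (fun j : J ⊕ J => Sum.elim (fun μ => fgrad n (liftEquiv (τ μ) ι)) (fun μ => bgrad n (liftEquiv (τ μ) ι)) j)) (fun p : X × ι => hX p.1)))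
      (fun y y' => ind S y * ((((Fintype.card J : ℝ) * (3 * (β * o₂ + m₀ * c₂) + 2 * (β₁ * o₁ + m₁ * c₁)) + rW) + β * rN * cr + m₀ * cN * cr
        + ((Fintype.card J : ℝ) * (2 * (rA * (c₁ * m₀ + o₁ * β + c₀ * m₁ + o₀ * β₁) + oAt * (c₁ * β + c₀ * β₁))) +
          β * (((ℓ * (Real.exp 1 * ε)⁻¹ + 2 * ω) * rV + 2 * o * RN)) * cr + m₀ * ((ℓ * (Real.exp 1 * ε)⁻¹ + 2 * ω) * RN) * cr)) * Real.exp (-(ρ * g.dist y y')))) := by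
  -- the sandwiches with the partition's lifted coefficients (supported in the transition layers, inside the cuts), at both grids
  have hsD : ∀ μ, G ∘ₗ fgrad n (liftEquiv (τ μ) ι) ∘ₗ mulOp (fgrad n (liftEquiv (τ μ) ι) (fun p : X × ι => hX p.1) ∘ ⇑(liftEquiv (τ μ) ι).symm) =
      TD μ ∘ₗ mulOp (fgrad n (liftEquiv (τ μ) ι) (fun p : X × ι => hX p.1) ∘ ⇑(liftEquiv (τ μ) ι).symm) := fun μ =>
    comp_mulOp_of_sandwich (hsXf μ) fun p hp => hlayf μ p.1 (by
      simp only [Function.comp_apply, fgrad_apply, liftEquiv_apply, liftEquiv_symm_apply, Equiv.apply_symm_apply] at hp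
      exact sub_ne_zero.mp (right_ne_zero_of_mul hp))
  have hsB : ∀ μ, G ∘ₗ bgrad n (liftEquiv (τ μ) ι) ∘ₗ mulOp (bgrad n (liftEquiv (τ μ) ι) (fun p : X × ι => hX p.1) ∘ ⇑(liftEquiv (τ μ) ι)) =
      TB μ ∘ₗ mulOp (bgrad n (liftEquiv (τ μ) ι) (fun p : X × ι => hX p.1) ∘ ⇑(liftEquiv (τ μ) ι)) := fun μ =>
    comp_mulOp_of_sandwich (hsXb μ) fun p hp => hlayb μ p.1 (by
      simp only [Function.comp_apply, bgrad_apply, liftEquiv_apply, liftEquiv_symm_apply, Equiv.symm_apply_apply] at hp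
      exact sub_ne_zero.mp (right_ne_zero_of_mul hp))
  have hsD' : ∀ μ, G' ∘ₗ fgrad n' (liftEquiv (τ' μ) ι) ∘ₗ mulOp (fgrad n' (liftEquiv (τ' μ) ι) (fun p : X' × ι => hX' p.1) ∘ ⇑(liftEquiv (τ' μ) ι).symm) =
      TD' μ ∘ₗ mulOp (fgrad n' (liftEquiv (τ' μ) ι) (fun p : X' × ι => hX' p.1) ∘ ⇑(liftEquiv (τ' μ) ι).symm) := fun μ =>
    comp_mulOp_of_sandwich (hsXf' μ) fun p hp => hlayf' μ p.1 (by
      simp only [Function.comp_apply, fgrad_apply, liftEquiv_apply, liftEquiv_symm_apply, Equiv.apply_symm_apply] at hp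
      exact sub_ne_zero.mp (right_ne_zero_of_mul hp))
  have hsB' : ∀ μ, G' ∘ₗ bgrad n' (liftEquiv (τ' μ) ι) ∘ₗ mulOp (bgrad n' (liftEquiv (τ' μ) ι) (fun p : X' × ι => hX' p.1) ∘ ⇑(liftEquiv (τ' μ) ι)) =
      TB' μ ∘ₗ mulOp (bgrad n' (liftEquiv (τ' μ) ι) (fun p : X' × ι => hX' p.1) ∘ ⇑(liftEquiv (τ' μ) ι)) := fun μ =>
    comp_mulOp_of_sandwich (hsXb' μ) fun p hp => hlayb' μ p.1 (by
      simp only [Function.comp_apply, bgrad_apply, liftEquiv_apply, liftEquiv_symm_apply, Equiv.symm_apply_apply] at hp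
      exact sub_ne_zero.mp (right_ne_zero_of_mul hp))
  -- the flat half (g13)
  have hflat := hasMaj_idef_comp_commOp_lapOp_of_sandwich (liftBlk blk ι) (liftMap π ι) (e := fun μ => liftEquiv (τ μ) ι) (e' := fun μ => liftEquiv (τ' μ) ι) hβ hβ₁ hc₁ hc₂ ho₁ ho₂ hm₀ hm₁
    hhD hhB hh2 hh2f hh2b hfD hfB hf2 hf2f hf2b hsD hsB hsD' hsB' hG' hTD' hTB' hDG hDTD hDTB hDW
  -- plus the nonlocal summand (w5)
  have hr₁ : 0 ≤ Fintype.card J * (3 * (β * o₂ + m₀ * c₂) + 2 * (β₁ * o₁ + m₁ * c₁)) + rW := by positivity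
  have h1 := hasMaj_idef_comp_commOp_of_add (liftBlk blk ι) (liftMap π ι) htri hd hrow hσ hr₁ hβ hm₀ hcN hrN hρ hρN hρδ hflat hG' hDG hKN hDKN
  -- the species + base half (FILE 154)
  have hlayf0 : ∀ μ x, hX x - hX ((τ μ).symm x) ≠ 0 → χX x = 1 := fun μ x h => hlayf μ x (sub_ne_zero.mp h)
  have hlayb0 : ∀ μ x, hX (τ μ x) - hX x ≠ 0 → χX x = 1 := fun μ x h => hlayb μ x (sub_ne_zero.mp h)
  have hlayf0' : ∀ μ x', hX' x' - hX' ((τ' μ).symm x') ≠ 0 → χX' x' = 1 := fun μ x h => hlayf' μ x (sub_ne_zero.mp h)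
  have hlayb0' : ∀ μ x', hX' (τ' μ x') - hX' x' ≠ 0 → χX' x' = 1 := fun μ x h => hlayb' μ x (sub_ne_zero.mp h)
  have h2 := hasMaj_idef_comp_commOp_dressedPert_of_sandwich blk π τ τ' n n' C C' A A' hX hX' G G' htri hd hsymm hrow hσ hβ hβ₁ hc₁ hc₀ ho₁ ho₀ hm₀ hm₁ hrA hoAt hRN hrV ho hℓ hω hε
    hρ hρV hρδ hh1 hh1b hh0 hh1' hh1b' hh0' hf1 hf1b hf0 hf0b hfit hLip hrh hrh' hA hfAb hfAf hlayf0 hlayb0 hlayf0' hlayb0' hsXf hsXb hsXf' hsXb' hG' hTD' hTB' hDG hDTD hDTB hNV hNV' hDNV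
  rw [commOp_sub_left, commOp_sub_left, LinearMap.comp_sub, LinearMap.comp_sub, idef_sub]
  refine (h1.sub h2).mono fun y y' => le_of_eq ?_
  ring

end Summit.QuantumFields.YangMills.BalabanUVNodes.N15.Gluing

end
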